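import Mathlib.MeasureTheory.Integral.Bochner.ContinuousLinearMap
import Mathlib.MeasureTheory.Measure.Lebesgue.Basic
import Mathlib.Topology.UniformSpace.Matrix
import Literature.MathematicalPhysics.QuantumLattice.LTQOFrustrationFreeProofs
import Literature.MathematicalPhysics.QuantumLattice.LiebRobinsonBoundProofs
import Literature.MathematicalPhysics.QuantumLattice.LiebRobinsonHastingsKomaSpectralProofs
import HarnessLib

/-!
# The smoothing map `𝓕_w(O) = ∫ w(t) τ_t(O) dt` (Michalakis–Zwolak, Lemma 1 (i)–(iii))

Sixth file of the formalisation of the Michalakis–Zwolak stability theorem (hubbard.S19). For a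
Hermitian Hamiltonian `H` with Heisenberg dynamics `τ_t(O) = e^{itH} O e^{−itH}` and an
integrable weight `w : ℝ → ℂ`, the operator `∫ w(t) • τ_t(O) dt` (a Bochner integral of
matrices; no new definition is introduced, the integral is written out) satisfies

* (i) `∫ w(t) • τ_t(H) dt = (∫ w) • H` (`integral_smul_heisenbergEvolution_self`), so `= H` when
  `∫ w = 1`;
* matrix elements in an eigenbasis `H uₖ = Eₖ uₖ`:
  `⟨uₖ, (∫ w • τ_t O) uₗ⟩ = (∫ e^{it(Eₖ − Eₗ)} w(t) dt) ⟨uₖ, O uₗ⟩`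
  (`eigenvector_dotProduct_integral_smul_heisenbergEvolution`), from
  `⟨uₖ, τ_t(O) uₗ⟩ = e^{it(Eₖ−Eₗ)} ⟨uₖ, O uₗ⟩`;
* (ii) if `ŵ` vanishes on the gap, `∫ e^{itΔ} w(t) dt = 0` for `|Δ| ≥ γ`, and a set `S` of
  eigen-indices is separated from its complement by `γ` (`|Eₖ − Eₗ| ≥ γ` for `k ∈ S ∌ l`), then
  `∫ w • τ_t O` commutes with the spectral projection onto `span {uₖ | k ∈ S}`
  (`commute_integral_smul_heisenbergEvolution_projMatrix`);
* (iii) `‖∫ w • τ_t O‖ ≤ (∫ ‖w‖) ‖O‖` (`norm_integral_smul_heisenbergEvolution_le`).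

These are properties (i)–(iii) of the operator `𝓕` of Michalakis–Zwolak, CMP **322** (2013) 277 =
arXiv:1109.1588, §5.1, Lemma 1 and its proof (p. 9: "`𝓕(H_s) = H_s`"; "the new interactions
commute with `P₀(s)`, since … `⟨ψ_n(s)|𝓕(O)|ψ₀(s)⟩ = ŵ_γ'(E_n(s) − E₀(s)) ⟨ψ_n(s)|O|ψ₀(s)⟩ = 0`";
"`‖𝓕(O_u(r))‖ ≤ ∫ dt w_γ'(t) ‖e^{itH_s} O e^{−itH_s}‖ = ‖O_u(r)‖`", here with `∫ ‖w‖` in place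
of `∫ w = 1`, the BMNS filter being non-negative). Property (iv) (quasi-locality) needs the
Lieb–Robinson bound and is not in this file. The lemmas `exp_smul_mulVec_eigenvectorBasis`
(`e^{cA} uᵢ = e^{cλᵢ} uᵢ`) and `conjTranspose_exp_I_mul_smul` are reused from
`LiebRobinsonHastingsKomaSpectralProofs`. No definitions, no named facts (theorems only).
-/

noncomputable section

open Matrix Complex NormedSpace MeasureTheory Finset
open scoped Matrix.Norms.L2Operator

namespace Literature.MathematicalPhysics.QuantumLattice

variable {n : Type*} [Fintype n] [DecidableEq n]

/-! ### Exponentials and the dynamics on eigenvectors -/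

/-- The backward propagator on an eigenvector: `e^{−itH} uₗ = e^{−itEₗ} uₗ`. [folklore] -/
theorem exp_neg_mulVec_eigenvectorBasis {H : Matrix n n ℂ} (hH : H.IsHermitian) (t : ℝ) (l : n) :
    exp ((-(I * t)) • H) *ᵥ (hH.eigenvectorBasis l : n → ℂ) =
      Complex.exp (-(I * t) * hH.eigenvalues l) • (hH.eigenvectorBasis l : n → ℂ) :=
  exp_smul_mulVec_eigenvectorBasis hH _ l

/-- **Matrix elements of the Heisenberg evolution in an eigenbasis**:
`⟨uₖ, τ_t(O) uₗ⟩ = e^{it(Eₖ − Eₗ)} ⟨uₖ, O uₗ⟩` (dot-product form `star uₖ ⬝ᵥ (τ_t(O) uₗ)`).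
MZ13 §5.1, proof of Lemma 1 (the computation behind "`⟨ψ_n| 𝓕(O) |ψ₀⟩ = ŵ(E_n − E₀) ⟨ψ_n| O |ψ₀⟩`",
arXiv:1109.1588 p. 9). [folklore] -/
theorem eigenvector_dotProduct_heisenbergEvolution_mulVec {H : Matrix n n ℂ} (hH : H.IsHermitian)
    (O : Matrix n n ℂ) (t : ℝ) (k l : n) :
    star (hH.eigenvectorBasis k : n → ℂ) ⬝ᵥ
        (heisenbergEvolution H t O *ᵥ (hH.eigenvectorBasis l : n → ℂ)) =
      Complex.exp (t * (hH.eigenvalues k - hH.eigenvalues l) * I) *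
        (star (hH.eigenvectorBasis k : n → ℂ) ⬝ᵥ (O *ᵥ (hH.eigenvectorBasis l : n → ℂ))) := by
  have hvec : star (hH.eigenvectorBasis k : n → ℂ) ᵥ* exp ((I * ↑t) • H) =
      Complex.exp (I * t * hH.eigenvalues k) • star (hH.eigenvectorBasis k : n → ℂ) := by
    have h1 : star (hH.eigenvectorBasis k : n → ℂ) ᵥ* exp ((I * ↑t) • H) =
        star ((exp ((I * ↑t) • H))ᴴ *ᵥ (hH.eigenvectorBasis k : n → ℂ)) := by
      rw [star_mulVec, conjTranspose_conjTranspose]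
    rw [h1, conjTranspose_exp_I_mul_smul hH, exp_neg_mulVec_eigenvectorBasis, star_smul]
    congr 1
    rw [Complex.star_def, ← Complex.exp_conj]
    congr 1
    simp only [map_mul, map_neg, Complex.conj_I, Complex.conj_ofReal]
    ring
  rw [heisenbergEvolution, ← mulVec_mulVec, ← mulVec_mulVec, exp_neg_mulVec_eigenvectorBasis,
    mulVec_smul, mulVec_smul, dotProduct_smul, dotProduct_mulVec, hvec, smul_dotProduct,
    smul_eq_mul, smul_eq_mul, ← mul_assoc, ← Complex.exp_add]
  congr 1
  congr 1
  ring

/-! ### The smoothed operator `∫ w(t) • τ_t(O) dt` -/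

/-- The integrand `t ↦ w(t) • τ_t(O)` is integrable for integrable `w` (`τ_t` is isometric).
[folklore] -/
theorem integrable_smul_heisenbergEvolution {H : Matrix n n ℂ} (hH : H.IsHermitian) {w : ℝ → ℂ}
    (hw : Integrable w) (O : Matrix n n ℂ) :
    Integrable fun t : ℝ => w t • heisenbergEvolution H t O := by
  refine (hw.norm.mul_const ‖O‖).mono'
    (hw.aestronglyMeasurable.smul (continuous_heisenbergEvolution H O).aestronglyMeasurable)
    (Filter.Eventually.of_forall fun t => ?_)
  rw [norm_smul, norm_heisenbergEvolution_holds hH]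

/-- **MZ13 Lemma 1 (i)**: `∫ w(t) • τ_t(H) dt = (∫ w) • H` (the Hamiltonian is a constant of
motion), hence `𝓕(H) = H` when `∫ w = 1` ("`𝓕(H_s) = … = (∫ dt w_γ'(t)) H_s = H_s`",
arXiv:1109.1588 p. 9). [cite: MichalakisZwolakCMP2013, §5.1 Lemma 1 (i) (arXiv:1109.1588 p. 9)] -/
theorem integral_smul_heisenbergEvolution_self (H : Matrix n n ℂ) (w : ℝ → ℂ) :
    ∫ t : ℝ, w t • heisenbergEvolution H t H = (∫ t : ℝ, w t) • H := by
  simp only [heisenbergEvolution_self]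
  exact integral_smul_const w H

/-- **MZ13 Lemma 1 (iii)**: `‖∫ w(t) • τ_t(O) dt‖ ≤ (∫ ‖w‖) ‖O‖` ("`‖𝓕(O_u(r))‖ ≤ ∫ dt w_γ'(t)
‖e^{itH_s} O_u(r) e^{−itH_s}‖ = ‖O_u(r)‖`", arXiv:1109.1588 p. 9, there for `w ≥ 0`, `∫ w = 1`).
[cite: MichalakisZwolakCMP2013, §5.1 Lemma 1 (iii) (arXiv:1109.1588 p. 9)] -/
theorem norm_integral_smul_heisenbergEvolution_le {H : Matrix n n ℂ} (hH : H.IsHermitian)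
    (w : ℝ → ℂ) (O : Matrix n n ℂ) :
    ‖∫ t : ℝ, w t • heisenbergEvolution H t O‖ ≤ (∫ t : ℝ, ‖w t‖) * ‖O‖ := by
  refine (norm_integral_le_integral_norm _).trans (le_of_eq ?_)
  rw [← integral_mul_const]
  refine integral_congr_ae (Filter.Eventually.of_forall fun t => ?_)
  simp only [norm_smul, norm_heisenbergEvolution_holds hH]

/-- The matrix element `M ↦ star u ⬝ᵥ (M v)` commutes with the Bochner integral. [folklore] -/
theorem dotProduct_integral_mulVec (u v : n → ℂ) {f : ℝ → Matrix n n ℂ} (hf : Integrable f) :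
    star u ⬝ᵥ ((∫ t : ℝ, f t) *ᵥ v) = ∫ t : ℝ, star u ⬝ᵥ (f t *ᵥ v) := by
  let L : Matrix n n ℂ →ₗ[ℂ] ℂ :=
    { toFun := fun M => star u ⬝ᵥ (M *ᵥ v)
      map_add' := fun M N => by simp only [add_mulVec, dotProduct_add]
      map_smul' := fun c M => by simp only [smul_mulVec, dotProduct_smul, RingHom.id_apply] }
  have h := ContinuousLinearMap.integral_comp_comm (LinearMap.toContinuousLinearMap L) hf
  exact h.symm

/-- **Matrix elements of the smoothed operator**:
`⟨uₖ, (∫ w • τ_t O) uₗ⟩ = (∫ e^{it(Eₖ−Eₗ)} w(t) dt) ⟨uₖ, O uₗ⟩`. MZ13 §5.1, proof of Lemma 1: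
"`⟨ψ_n(s)| 𝓕(O_u(r)) |ψ₀(s)⟩ = ŵ_γ'(E_n(s) − E₀(s)) ⟨ψ_n(s)| O_u(r) |ψ₀(s)⟩`" (arXiv:1109.1588
p. 9). [cite: MichalakisZwolakCMP2013, §5.1 proof of Lemma 1 (arXiv:1109.1588 p. 9)] -/
theorem eigenvector_dotProduct_integral_smul_heisenbergEvolution {H : Matrix n n ℂ}
    (hH : H.IsHermitian) {w : ℝ → ℂ} (hw : Integrable w) (O : Matrix n n ℂ) (k l : n) :
    star (hH.eigenvectorBasis k : n → ℂ) ⬝ᵥ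
        ((∫ t : ℝ, w t • heisenbergEvolution H t O) *ᵥ (hH.eigenvectorBasis l : n → ℂ)) =
      (∫ t : ℝ, Complex.exp (t * (hH.eigenvalues k - hH.eigenvalues l) * I) * w t) *
        (star (hH.eigenvectorBasis k : n → ℂ) ⬝ᵥ (O *ᵥ (hH.eigenvectorBasis l : n → ℂ))) := by
  rw [dotProduct_integral_mulVec _ _ (integrable_smul_heisenbergEvolution hH hw O),
    ← integral_mul_const]
  refine integral_congr_ae (Filter.Eventually.of_forall fun t => ?_)
  dsimp only
  rw [smul_mulVec, dotProduct_smul, smul_eq_mul,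
    eigenvector_dotProduct_heisenbergEvolution_mulVec hH O t k l]
  ring

/-! ### Commutation with separated spectral projections (MZ13 Lemma 1 (ii)) -/

/-- The spectral projection onto `span {uₖ | k ∈ S}` acts on the eigenbasis as the indicator of
`S`: `P uₗ = uₗ` for `l ∈ S` and `P uₗ = 0` for `l ∉ S`. [folklore] -/
theorem projMatrix_span_mulVec_eigenvectorBasis {H : Matrix n n ℂ} (hH : H.IsHermitian)
    (S : Finset n) (l : n) :
    projMatrix (Submodule.span ℂ (Set.range fun i : S => hH.eigenvectorBasis i)) *ᵥ
        (hH.eigenvectorBasis l : n → ℂ) =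
      if l ∈ S then (hH.eigenvectorBasis l : n → ℂ) else 0 := by
  rw [projMatrix_mulVec]
  split_ifs with hl
  · have hmem : (hH.eigenvectorBasis l : EuclideanSpace ℂ n) ∈
        Submodule.span ℂ (Set.range fun i : S => hH.eigenvectorBasis i) :=
      Submodule.subset_span ⟨⟨l, hl⟩, rfl⟩
    rw [Submodule.starProjection_eq_self_iff.mpr hmem]
  · have hmem : (hH.eigenvectorBasis l : EuclideanSpace ℂ n) ∈
        (Submodule.span ℂ (Set.range fun i : S => hH.eigenvectorBasis i))ᗮ := by
      rw [orthogonal_span_eigenvectorBasis hH S]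
      exact Submodule.subset_span ⟨⟨l, by simpa using hl⟩, rfl⟩
    rw [(Submodule.starProjection_apply_eq_zero_iff _).mpr hmem, WithLp.ofLp_zero]

/-- A vector orthogonal to every eigenbasis vector vanishes. [folklore] -/
theorem eq_zero_of_eigenvector_dotProduct_eq_zero {H : Matrix n n ℂ} (hH : H.IsHermitian)
    {v : n → ℂ} (h : ∀ k, star (hH.eigenvectorBasis k : n → ℂ) ⬝ᵥ v = 0) : v = 0 := by
  set U : Matrix n n ℂ := (hH.eigenvectorUnitary : Matrix n n ℂ) with hU
  have h1 : star U *ᵥ v = 0 := by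
    funext k
    rw [Pi.zero_apply, ← h k, mulVec, dotProduct, dotProduct]
    refine sum_congr rfl fun j _ => ?_
    rw [hU, star_apply, IsHermitian.eigenvectorUnitary_apply, Pi.star_apply]
  have h2 : U *ᵥ (star U *ᵥ v) = v := by
    rw [mulVec_mulVec, hU, Unitary.mul_star_self_of_mem hH.eigenvectorUnitary.prop, one_mulVec]
  rw [← h2, h1, mulVec_zero]

/-- A matrix killing every eigenbasis vector vanishes. [folklore] -/
theorem eq_zero_of_mulVec_eigenvectorBasis_eq_zero {H : Matrix n n ℂ} (hH : H.IsHermitian)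
    {M : Matrix n n ℂ} (h : ∀ l, M *ᵥ (hH.eigenvectorBasis l : n → ℂ) = 0) : M = 0 := by
  set U : Matrix n n ℂ := (hH.eigenvectorUnitary : Matrix n n ℂ) with hU
  have h1 : M * U = 0 := by
    ext i j
    have := congrFun (h j) i
    rw [← hH.eigenvectorUnitary_mulVec j, mulVec_mulVec, mulVec_single_one] at this
    simpa using this
  calc M = M * U * star U := by
        rw [Matrix.mul_assoc, hU, Unitary.mul_star_self_of_mem hH.eigenvectorUnitary.prop,
          Matrix.mul_one]
    _ = 0 := by rw [h1, Matrix.zero_mul]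

/-- **MZ13 Lemma 1 (ii): the smoothed operator commutes with separated spectral projections.**
Let `H` be Hermitian with eigenbasis `uₖ`, eigenvalues `Eₖ`, let `S` be a set of indices whose
eigenvalues are separated from the others by `γ` (`|Eₖ − Eₗ| ≥ γ` for `k ∈ S`, `l ∉ S`), and let
the integrable weight `w` satisfy `∫ e^{itΔ} w(t) dt = 0` for all `|Δ| ≥ γ` (its Fourier transform
vanishes outside the gap, `exists_schwartz_filter`). Then `∫ w(t) • τ_t(O) dt` commutes with the
spectral projection `P_S` onto `span {uₖ | k ∈ S}`, for every `O`: the matrix elements of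
`[∫ w • τ_t O, P_S]` between `uₖ`, `uₗ` are `(𝟙[l ∈ S] − 𝟙[k ∈ S]) ŵ(Eₖ − Eₗ) ⟨uₖ, O uₗ⟩ = 0`.
MZ13 §5.1 Lemma 1 (ii) and its proof (arXiv:1109.1588 p. 9: "`(1 − P₀(s)) 𝓕(O) P₀(s) = 0 =
P₀(s) 𝓕(O) (1 − P₀(s))`, hence `𝓕(O) P₀(s) = P₀(s) 𝓕(O)`").
[cite: MichalakisZwolakCMP2013, §5.1 Lemma 1 (ii) (arXiv:1109.1588 p. 9)] -/
theorem commute_integral_smul_heisenbergEvolution_projMatrix {H : Matrix n n ℂ}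
    (hH : H.IsHermitian) {w : ℝ → ℂ} (hw : Integrable w) {γ : ℝ}
    (hfilter : ∀ Δ : ℝ, γ ≤ |Δ| → ∫ t : ℝ, Complex.exp (t * Δ * I) * w t = 0)
    (S : Finset n) (hsep : ∀ k ∈ S, ∀ l ∉ S, γ ≤ |hH.eigenvalues k - hH.eigenvalues l|)
    (O : Matrix n n ℂ) :
    Commute (∫ t : ℝ, w t • heisenbergEvolution H t O)
      (projMatrix (Submodule.span ℂ (Set.range fun i : S => hH.eigenvectorBasis i))) := by
  set F : Matrix n n ℂ := ∫ t : ℝ, w t • heisenbergEvolution H t O with hF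
  set P : Matrix n n ℂ := projMatrix (Submodule.span ℂ (Set.range fun i : S => hH.eigenvectorBasis i))
    with hP
  have hPh : P.IsHermitian := projMatrix_isHermitian _
  -- the vanishing matrix elements
  have hvanish : ∀ k l, ¬ (k ∈ S ↔ l ∈ S) →
      star (hH.eigenvectorBasis k : n → ℂ) ⬝ᵥ (F *ᵥ (hH.eigenvectorBasis l : n → ℂ)) = 0 := by
    intro k l hkl
    rw [hF, eigenvector_dotProduct_integral_smul_heisenbergEvolution hH hw O k l]
    simp only [← Complex.ofReal_sub]
    rw [hfilter, zero_mul]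
    rcases not_iff.mp hkl |>.symm |> iff_iff_and_or_not_and_not.mp with ⟨hl, hk⟩ | ⟨hl, hk⟩
    · -- `l ∈ S`, `k ∉ S`
      have := hsep l hl k (by simpa using hk)
      rwa [abs_sub_comm] at this
    · exact hsep k (by simpa using hk) l hl
  -- compare `F P` and `P F` on the eigenbasis, matrix element by matrix element
  show F * P = P * F
  rw [← sub_eq_zero]
  refine eq_zero_of_mulVec_eigenvectorBasis_eq_zero hH fun l => ?_
  refine eq_zero_of_eigenvector_dotProduct_eq_zero hH fun k => ?_
  rw [Matrix.sub_mulVec, dotProduct_sub, ← mulVec_mulVec, ← mulVec_mulVec,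
    projMatrix_span_mulVec_eigenvectorBasis hH S l, dotProduct_mulVec _ P,
    show star (hH.eigenvectorBasis k : n → ℂ) ᵥ* P = star (P *ᵥ (hH.eigenvectorBasis k : n → ℂ)) by
      rw [star_mulVec, hPh.eq],
    projMatrix_span_mulVec_eigenvectorBasis hH S k]
  by_cases hk : k ∈ S <;> by_cases hl : l ∈ S
  · simp [hk, hl]
  · rw [if_neg hl, if_pos hk, mulVec_zero, dotProduct_zero, zero_sub, neg_eq_zero]
    exact hvanish k l (by tauto)
  · rw [if_pos hl, if_neg hk, star_zero, zero_dotProduct, sub_zero]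
    exact hvanish k l (by tauto)
  · simp [hk, hl]

end Literature.MathematicalPhysics.QuantumLattice
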